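import Summits.HubbardSuperconductivity.HubbardSuperconductivity.Theorems.AnisotropyChordTransferFibre3NDeriv
import Summits.HubbardSuperconductivity.HubbardSuperconductivity.Theorems.AnisotropyChordTransferFibre3IMS
import Summits.HubbardSuperconductivity.HubbardSuperconductivity.Theorems.AnisotropyChordTransferFibre3Krein

/-!
# Route `AnisotropyChord` / H0 rotor rung: PORT N30-A — block structure of the Krein matrix and the Schur reduction of invertibility

Memo ROTOR-THEORY-20 §279(d) (theory seat `hubbard-h0-rotor-theory-1`, cycle 20): `𝒩 = [[P, Bᴴ],[B, −Q_S]]` with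
`P = (G_T)_{DD}`; `P` is positive definite — indeed injective: `⟨x, P x⟩ = V⁻² Σ' |Z_k(x)|²/den_k`, and a `D`-supported
function whose Fourier transform lives on the three poles vanishes (`L ≥ 4`) — so `det 𝒩(T) ≠ 0 ⇔ det(Q_S + B P⁻¹ Bᴴ) ≠ 0`
(`det_Nmat_ne_zero_iff`), and `NInvertibleBelow L Δ T*` follows from the shell statement `∀ T ≤ T*, det Q̃(T) ≠ 0`
(`nInvertibleBelow_of_shell`, the form in which LEMMA L2/κ₀ delivers it).
Prover seat `hubbard-h0-rotor-p1` g21; helper for stmt-HubbardSuperconductivity-19089 (`--supports`).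
-/

set_option linter.dupNamespace false
set_option autoImplicit false

noncomputable section

open scoped BigOperators
open Complex Matrix

namespace Summit.HubbardSuperconductivity.HubbardSuperconductivity.Theorems.AnisotropyChord.Transfer.Fibre3

variable (L : ℕ) [NeZero L]

/-- hard-core index type. [folklore] -/
abbrev Dsub := {c : Cfg L // InD L c = true}
/-- shell index type. [folklore] -/
abbrev Ssub := {c : Cfg L // InS L c = true}

/-- `P = (G_T)_{DD}`. [folklore] -/
def Pmat (T : ℝ) : Matrix (Dsub L) (Dsub L) ℂ := fun d d' => Gentry L T d.1 d'.1
/-- `Bᴴ = (G_T)_{DS}`. [folklore] -/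
def BHmat (T : ℝ) : Matrix (Dsub L) (Ssub L) ℂ := fun d s => Gentry L T d.1 s.1
/-- `B = (G_T)_{SD}`. [folklore] -/
def Bmat (T : ℝ) : Matrix (Ssub L) (Dsub L) ℂ := fun s d => Gentry L T s.1 d.1
/-- `−Q_S = (G_T)_{SS} − (ΔW)⁻¹`. [folklore] -/
def Cmat (T Δ : ℝ) : Matrix (Ssub L) (Ssub L) ℂ := fun s s' =>
  Gentry L T s.1 s'.1 - (if s = s' then ((1 / (Δ * (Wcount L s.1 : ℝ)) : ℝ) : ℂ) else 0)
/-- the shell matrix `Q̃ = Q_S + B P⁻¹ Bᴴ = (ΔW)⁻¹ − G_SS + G_SD G_DD⁻¹ G_DS`. [folklore] -/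
def Qtilde (T Δ : ℝ) : Matrix (Ssub L) (Ssub L) ℂ := -(Cmat L T Δ - Bmat L T * (Pmat L T)⁻¹ * BHmat L T)

/-- **block form of the Krein matrix.** [folklore] -/
theorem Nmat_eq_fromBlocks (T Δ : ℝ) :
    Nmat L T Δ = Matrix.fromBlocks (Pmat L T) (BHmat L T) (Bmat L T) (Cmat L T Δ) := by
  ext i j
  rcases i with d | s <;> rcases j with d' | s'
  · rw [Matrix.fromBlocks_apply₁₁, Nmat_inl]; rfl
  · rw [Matrix.fromBlocks_apply₁₂, Nmat_inl]; rfl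
  · rw [Matrix.fromBlocks_apply₂₁, Nmat_inr_inl]; rfl
  · rw [Matrix.fromBlocks_apply₂₂, Nmat_inr_inr]; rfl

/-! ## `P` is injective -/

/-- weights `1/den` off the poles. [folklore] -/
def w1 (T : ℝ) (k : Tor L × Tor L) : ℝ := if IsPoleK1 L k.1 k.2 then 0 else 1 / den L T k.1 k.2

/-- `G_T` as a weighted sum of rank-one plane-wave kernels. [folklore] -/
theorem Gentry_eq_w1 (T : ℝ) (c c' : Cfg L) :
    Gentry L T c c' = (1 / ((L : ℂ) ^ 2) ^ 2) * ∑ k : Tor L × Tor L,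
      (w1 L T k : ℂ) * (pw L k.1 k.2 c * (starRingEnd ℂ) (pw L k.1 k.2 c')) := by
  rw [Gentry_eq]
  unfold w1
  congr 1
  refine Finset.sum_congr rfl fun k _ => ?_
  split_ifs
  · simp
  · push_cast; ring

/-- `D`-mode amplitudes `Z_k(x) = Σ_{d ∈ D} conj(pw_k(d)) x_d`. [folklore] -/
def ZD (x : Dsub L → ℂ) (k : Tor L × Tor L) : ℂ := ∑ d : Dsub L, (starRingEnd ℂ) (pw L k.1 k.2 d.1) * x d

/-- `(P x)_d = V⁻² Σ_k w_k pw_k(d) Z_k(x)`. [folklore] -/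
theorem P_mulVec (T : ℝ) (x : Dsub L → ℂ) (d : Dsub L) :
    (Pmat L T).mulVec x d
      = (1 / ((L : ℂ) ^ 2) ^ 2) * ∑ k : Tor L × Tor L, (w1 L T k : ℂ) * (pw L k.1 k.2 d.1 * ZD L x k) := by
  simp only [Matrix.mulVec, dotProduct]
  unfold Pmat
  simp_rw [Gentry_eq_w1]
  unfold ZD
  calc ∑ j : Dsub L, ((1 / ((L : ℂ) ^ 2) ^ 2) * ∑ k : Tor L × Tor L,
          (w1 L T k : ℂ) * (pw L k.1 k.2 d.1 * (starRingEnd ℂ) (pw L k.1 k.2 j.1))) * x j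
      = ∑ j : Dsub L, ∑ k : Tor L × Tor L, (1 / ((L : ℂ) ^ 2) ^ 2) *
          ((w1 L T k : ℂ) * (pw L k.1 k.2 d.1 * ((starRingEnd ℂ) (pw L k.1 k.2 j.1) * x j))) := by
        refine Finset.sum_congr rfl fun j _ => ?_
        rw [Finset.mul_sum, Finset.sum_mul]
        refine Finset.sum_congr rfl fun k _ => ?_
        ring
    _ = ∑ k : Tor L × Tor L, ∑ j : Dsub L, (1 / ((L : ℂ) ^ 2) ^ 2) *
          ((w1 L T k : ℂ) * (pw L k.1 k.2 d.1 * ((starRingEnd ℂ) (pw L k.1 k.2 j.1) * x j))) := Finset.sum_comm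
    _ = (1 / ((L : ℂ) ^ 2) ^ 2) * ∑ k : Tor L × Tor L, (w1 L T k : ℂ) * (pw L k.1 k.2 d.1
          * ∑ j : Dsub L, (starRingEnd ℂ) (pw L k.1 k.2 j.1) * x j) := by
        rw [Finset.mul_sum]
        refine Finset.sum_congr rfl fun k _ => ?_
        rw [Finset.mul_sum, Finset.mul_sum, Finset.mul_sum]

/-- `⟨x, P x⟩ = V⁻² Σ_k w_k |Z_k(x)|²`. [folklore] -/
theorem P_form (T : ℝ) (x : Dsub L → ℂ) :
    star x ⬝ᵥ (Pmat L T).mulVec x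
      = (1 / ((L : ℂ) ^ 2) ^ 2) * ∑ k : Tor L × Tor L, (w1 L T k : ℂ) * ((starRingEnd ℂ) (ZD L x k) * ZD L x k) := by
  simp only [dotProduct, Pi.star_apply, star_def]
  simp_rw [P_mulVec]
  have hconj : ∀ k : Tor L × Tor L,
      (starRingEnd ℂ) (ZD L x k) = ∑ i : Dsub L, (starRingEnd ℂ) (x i) * pw L k.1 k.2 i.1 := by
    intro k; unfold ZD; rw [map_sum]
    refine Finset.sum_congr rfl fun i _ => ?_
    rw [map_mul, Complex.conj_conj]; ring
  calc ∑ i : Dsub L, (starRingEnd ℂ) (x i) * ((1 / ((L : ℂ) ^ 2) ^ 2) * ∑ k : Tor L × Tor L,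
          (w1 L T k : ℂ) * (pw L k.1 k.2 i.1 * ZD L x k))
      = ∑ i : Dsub L, ∑ k : Tor L × Tor L, (1 / ((L : ℂ) ^ 2) ^ 2) *
          ((w1 L T k : ℂ) * (((starRingEnd ℂ) (x i) * pw L k.1 k.2 i.1) * ZD L x k)) := by
        refine Finset.sum_congr rfl fun i _ => ?_
        rw [Finset.mul_sum, Finset.mul_sum]
        refine Finset.sum_congr rfl fun k _ => ?_
        ring
    _ = ∑ k : Tor L × Tor L, ∑ i : Dsub L, (1 / ((L : ℂ) ^ 2) ^ 2) *
          ((w1 L T k : ℂ) * (((starRingEnd ℂ) (x i) * pw L k.1 k.2 i.1) * ZD L x k)) := Finset.sum_comm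
    _ = (1 / ((L : ℂ) ^ 2) ^ 2) * ∑ k : Tor L × Tor L, (w1 L T k : ℂ) * ((starRingEnd ℂ) (ZD L x k) * ZD L x k) := by
        rw [Finset.mul_sum]
        refine Finset.sum_congr rfl fun k _ => ?_
        rw [hconj k, Finset.sum_mul, Finset.mul_sum, Finset.mul_sum]

/-- if `P x = 0` then every non-pole amplitude `Z_k(x)` vanishes (`T < 2ε₁`, `L ≥ 4`: all weights positive). [folklore] -/
theorem ZD_eq_zero_of_mulVec (hL : 4 ≤ L) {T : ℝ} (hT : T < 2 * eps1 L) (x : Dsub L → ℂ)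
    (hx : (Pmat L T).mulVec x = 0) {k : Tor L × Tor L} (hk : IsPoleK1 L k.1 k.2 = false) : ZD L x k = 0 := by
  have h := P_form L T x
  rw [hx, dotProduct_zero] at h
  have hV : (1 / ((L : ℂ) ^ 2) ^ 2) = (((1 / ((L : ℝ) ^ 2) ^ 2 : ℝ)) : ℂ) := by push_cast; ring
  have hVpos : 0 < (1 / ((L : ℝ) ^ 2) ^ 2 : ℝ) := by
    have : (0 : ℝ) < L := by exact_mod_cast Nat.pos_of_ne_zero (NeZero.ne L)
    positivity
  have hre := congrArg Complex.re h
  rw [hV, Complex.re_ofReal_mul, Complex.zero_re, Complex.re_sum] at hre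
  have hterm : ∀ k' : Tor L × Tor L, ((w1 L T k' : ℂ) * ((starRingEnd ℂ) (ZD L x k') * ZD L x k')).re
      = w1 L T k' * ‖ZD L x k'‖ ^ 2 := by
    intro k'
    rw [Complex.re_ofReal_mul, Complex.conj_mul', show ((‖ZD L x k'‖ : ℂ) ^ 2) = (((‖ZD L x k'‖ ^ 2 : ℝ)) : ℂ) by
      push_cast; ring, Complex.ofReal_re]
  simp_rw [hterm] at hre
  have hnn : ∀ k' ∈ (Finset.univ : Finset (Tor L × Tor L)), 0 ≤ w1 L T k' * ‖ZD L x k'‖ ^ 2 := by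
    intro k' _
    apply mul_nonneg _ (sq_nonneg _)
    unfold w1; split_ifs with h'
    · exact le_rfl
    · have h'' : IsPoleK1 L k'.1 k'.2 = false := by simpa using h'
      exact le_of_lt (one_div_pos.mpr (den_pos L hL hT h''))
  have hsum : ∑ k' : Tor L × Tor L, w1 L T k' * ‖ZD L x k'‖ ^ 2 = 0 := by
    rcases mul_eq_zero.mp hre.symm with h0 | h0
    · exact absurd h0 (ne_of_gt hVpos)
    · exact h0
  have hk0 := (Finset.sum_eq_zero_iff_of_nonneg hnn).1 hsum k (Finset.mem_univ _)
  have hw : 0 < w1 L T k := by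
    unfold w1; simp only [hk, Bool.false_eq_true, if_false]; exact one_div_pos.mpr (den_pos L hL hT hk)
  rcases mul_eq_zero.mp hk0 with h1 | h1
  · exact absurd h1 (ne_of_gt hw)
  · exact norm_eq_zero.mp (pow_eq_zero_iff (two_ne_zero) |>.mp h1)

/-- extension by zero of a `D`-vector to the fibre. [folklore] -/
def extD (x : Dsub L → ℂ) : Cfg L → ℂ := fun c => if h : InD L c = true then x ⟨c, h⟩ else 0

/-- `⟨pw_k, x̂⟩ = Z_k(x)`. [folklore] -/
theorem ip_pw_extD (x : Dsub L → ℂ) (k : Tor L × Tor L) : ip L (pw L k.1 k.2) (extD L x) = ZD L x k := by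
  unfold ip ZD
  have h1 : ∑ c : Cfg L, (starRingEnd ℂ) (pw L k.1 k.2 c) * extD L x c
      = ∑ c ∈ Finset.univ.filter (fun c : Cfg L => InD L c = true), (starRingEnd ℂ) (pw L k.1 k.2 c) * extD L x c := by
    rw [Finset.sum_filter]
    refine Finset.sum_congr rfl fun c _ => ?_
    unfold extD
    split_ifs <;> simp
  rw [h1, Finset.sum_subtype (Finset.univ.filter fun c : Cfg L => InD L c = true) (p := fun c => InD L c = true)
    (by intro c; simp)]
  refine Finset.sum_congr rfl fun d _ => ?_
  unfold extD
  rw [dif_pos d.2]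

/-- Fourier inversion for `x̂` when the non-pole amplitudes vanish: `x̂ = V⁻²(Z₀₀ + Z_{K₁0} e^{iK₁·a} + Z_{0K₁} e^{iK₁·b})`.
[folklore] -/
theorem extD_eq (hL : 2 ≤ L) (x : Dsub L → ℂ) (hZ : ∀ k : Tor L × Tor L, IsPoleK1 L k.1 k.2 = false → ZD L x k = 0)
    (c : Cfg L) :
    extD L x c = (1 / ((L : ℂ) ^ 2) ^ 2) *
      (ZD L x (0, 0) + ZD L x (K1 L, 0) * phase L (K1 L) c.1 + ZD L x (0, K1 L) * phase L (K1 L) c.2) := by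
  rw [← fourier_inversion L (extD L x) c]
  congr 1
  rw [show ∑ k : Tor L × Tor L, ip L (pw L k.1 k.2) (extD L x) * pw L k.1 k.2 c
      = ∑ k : Tor L × Tor L, (if IsPoleK1 L k.1 k.2 then ZD L x k * pw L k.1 k.2 c else 0) from
    Finset.sum_congr rfl fun k _ => by
      rw [ip_pw_extD]
      split_ifs with h
      · rfl
      · have h' : IsPoleK1 L k.1 k.2 = false := by simpa using h
        rw [hZ k h', zero_mul]]
  rw [sum_pole L hL]
  simp only [pw_pole₀, pw_pole₁, pw_pole₂, mul_one]

omit [NeZero L] in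
/-- `ε₁ > 0` for `L ≥ 4`. [folklore] -/
theorem eps1_pos [NeZero L] (hL : 4 ≤ L) : 0 < eps1 L := by
  unfold eps1
  have hL' : (4 : ℝ) ≤ L := by exact_mod_cast hL
  have h1 : (0 : ℝ) < 2 * Real.pi / L := by positivity
  have h2 : 2 * Real.pi / L ≤ Real.pi / 2 := by
    rw [div_le_div_iff₀ (by positivity) (by norm_num)]
    nlinarith [Real.pi_pos]
  have := Real.cos_lt_cos_of_nonneg_of_le_pi_div_two le_rfl h2 h1
  rw [Real.cos_zero] at this
  linarith

/-- **`P = (G_T)_{DD}` is injective** (`T < 2ε₁`, `L ≥ 4`). [folklore] -/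
theorem P_mulVec_injective (hL : 4 ≤ L) {T : ℝ} (hT : T < 2 * eps1 L) (x : Dsub L → ℂ)
    (hx : (Pmat L T).mulVec x = 0) : x = 0 := by
  have hL2 : 2 ≤ L := by omega
  have hL3 : 3 ≤ L := by omega
  have hZ : ∀ k : Tor L × Tor L, IsPoleK1 L k.1 k.2 = false → ZD L x k = 0 :=
    fun k hk => ZD_eq_zero_of_mulVec L hL hT x hx hk
  have hext := extD_eq L hL2 x hZ
  -- the pole phase `u = e^{iθ}` is neither `0` nor `1`
  set u : ℂ := phase L (K1 L) (ex L) with hu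
  have hu1 : u ≠ 1 := by
    intro h
    have := normSq_phase_K1_ex L hL2
    rw [← hu, h, sub_self, map_zero] at this
    have := eps1_pos L hL; linarith
  have hu0 : u ≠ 0 := by
    intro h
    have := normSq_phase L (K1 L) (ex L)
    rw [← hu, h, map_zero] at this
    exact zero_ne_one this
  have hey : phase L (K1 L) (ey L) = 1 := (phase_K1_ey L).1
  have hexex : phase L (K1 L) (ex L + ex L) = u * u := by rw [phase_add]
  -- ZMod facts
  have one_ne : (1 : ZMod L) ≠ 0 := by
    intro h
    have h' : ((1 : ℕ) : ZMod L) = 0 := by exact_mod_cast h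
    rw [ZMod.natCast_eq_zero_iff] at h'
    have := Nat.le_of_dvd Nat.one_pos h'; omega
  have two_ne : (2 : ZMod L) ≠ 0 := by
    intro h
    have h' : ((2 : ℕ) : ZMod L) = 0 := by exact_mod_cast h
    rw [ZMod.natCast_eq_zero_iff] at h'
    have := Nat.le_of_dvd (by norm_num) h'; omega
  have hex0 : ex L ≠ 0 := fun h => one_ne (by have := congrArg Prod.fst h; simpa [ex] using this)
  have hey0 : ey L ≠ 0 := fun h => one_ne (by have := congrArg Prod.snd h; simpa [ey] using this)
  have hexey : ex L ≠ ey L := fun h => one_ne (by have := congrArg Prod.fst h; simpa [ex, ey] using this)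
  have h2ex0 : ex L + ex L ≠ 0 := fun h => two_ne (by
    have := congrArg Prod.fst h; simp only [ex, Prod.fst_add, Prod.fst_zero] at this; linear_combination this)
  have h2exey : ex L + ex L ≠ ey L := fun h => two_ne (by
    have := congrArg Prod.fst h; simp only [ex, ey, Prod.fst_add] at this; linear_combination this)
  -- off-`D` test configurations
  have offD : ∀ a b : Tor L, a ≠ 0 → b ≠ 0 → a ≠ b → InD L (a, b) = false := by
    intro a b ha hb hab; unfold InD; simp [ha, hb, hab]
  have hV : (1 / ((L : ℂ) ^ 2) ^ 2) ≠ 0 := by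
    have : (L : ℂ) ≠ 0 := by exact_mod_cast (NeZero.ne L)
    exact one_div_ne_zero (pow_ne_zero _ (pow_ne_zero _ this))
  have ev : ∀ a b : Tor L, InD L (a, b) = false →
      ZD L x (0, 0) + ZD L x (K1 L, 0) * phase L (K1 L) a + ZD L x (0, K1 L) * phase L (K1 L) b = 0 := by
    intro a b hab
    have h0 : extD L x (a, b) = 0 := by unfold extD; simp [hab]
    rw [hext] at h0
    rcases mul_eq_zero.mp h0 with h | h
    · exact absurd h hV
    · exact h
  have e1 := ev (ex L) (ey L) (offD _ _ hex0 hey0 hexey)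
  have e2 := ev (ex L + ex L) (ey L) (offD _ _ h2ex0 hey0 h2exey)
  have e3 := ev (ey L) (ex L) (offD _ _ hey0 hex0 hexey.symm)
  have e4 := ev (ey L) (ex L + ex L) (offD _ _ hey0 h2ex0 (fun h => h2exey h.symm))
  rw [hey] at e1 e2 e3 e4
  rw [hexex] at e2 e4
  rw [← hu] at e1 e3
  -- solve: B = 0, C = 0, A = 0
  set A := ZD L x (0, 0)
  set B := ZD L x (K1 L, 0)
  set C := ZD L x (0, K1 L)
  have hB : B = 0 := by
    have h : B * (u * (1 - u)) = 0 := by linear_combination e1 - e2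
    rcases mul_eq_zero.mp h with h | h
    · exact h
    · rcases mul_eq_zero.mp h with h | h
      · exact absurd h hu0
      · exact absurd (by linear_combination -h) hu1
  have hC : C = 0 := by
    have h : C * (u * (1 - u)) = 0 := by linear_combination e3 - e4
    rcases mul_eq_zero.mp h with h | h
    · exact h
    · rcases mul_eq_zero.mp h with h | h
      · exact absurd h hu0
      · exact absurd (by linear_combination -h) hu1
  have hA : A = 0 := by rw [hB, hC] at e3; linear_combination e3
  -- hence `x̂ = 0` and `x = 0`
  funext d
  have hd : extD L x d.1 = x d := by unfold extD; simp [d.2]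
  rw [← hd, hext, hA, hB, hC]
  simp

/-- `det P ≠ 0`. [folklore] -/
theorem det_P_ne_zero (hL : 4 ≤ L) {T : ℝ} (hT : T < 2 * eps1 L) : (Pmat L T).det ≠ 0 := by
  intro h
  obtain ⟨v, hv, hPv⟩ := Matrix.exists_mulVec_eq_zero_iff.mpr h
  exact hv (P_mulVec_injective L hL hT v hPv)

/-! ## Schur reduction -/

/-- **Schur factorisation of `det 𝒩`.** [folklore] -/
theorem det_Nmat_eq (hL : 4 ≤ L) {T : ℝ} (hT : T < 2 * eps1 L) (Δ : ℝ) :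
    (Nmat L T Δ).det = (Pmat L T).det * (Cmat L T Δ - Bmat L T * (Pmat L T)⁻¹ * BHmat L T).det := by
  rw [Nmat_eq_fromBlocks]
  have hP : IsUnit (Pmat L T).det := isUnit_iff_ne_zero.mpr (det_P_ne_zero L hL hT)
  letI : Invertible (Pmat L T) := Matrix.invertibleOfIsUnitDet (Pmat L T) hP
  rw [Matrix.det_fromBlocks₁₁, Matrix.invOf_eq_nonsing_inv]

/-- **`det 𝒩(T) ≠ 0 ⇔ det Q̃(T) ≠ 0`** (`T < 2ε₁`, `L ≥ 4`). [folklore] -/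
theorem det_Nmat_ne_zero_iff (hL : 4 ≤ L) {T : ℝ} (hT : T < 2 * eps1 L) (Δ : ℝ) :
    (Nmat L T Δ).det ≠ 0 ↔ (Qtilde L T Δ).det ≠ 0 := by
  rw [det_Nmat_eq L hL hT Δ]
  unfold Qtilde
  rw [Matrix.det_neg, mul_ne_zero_iff, mul_ne_zero_iff]
  have hP := det_P_ne_zero L hL hT
  have hs : ((-1 : ℂ) ^ Fintype.card (Ssub L)) ≠ 0 := pow_ne_zero _ (by norm_num)
  tauto

/-- **`NInvertibleBelow` from the shell:** if `det Q̃(T) ≠ 0` for all `T ≤ T*` (`T* < 2ε₁`; this is what LEMMA L2/κ₀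
provides, `Q̃(T) ≻ 0`), then `𝒩(T)` is invertible for all `T ≤ T*`. [folklore] -/
theorem nInvertibleBelow_of_shell (hL : 4 ≤ L) (Δ Tstar : ℝ) (hTs : Tstar < 2 * eps1 L)
    (h : ∀ T : ℝ, T ≤ Tstar → (Qtilde L T Δ).det ≠ 0) : NInvertibleBelow L Δ Tstar := by
  intro T hT
  exact (det_Nmat_ne_zero_iff L hL (lt_of_le_of_lt hT hTs) Δ).2 (h T hT)

end Summit.HubbardSuperconductivity.HubbardSuperconductivity.Theorems.AnisotropyChord.Transfer.Fibre3

end
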